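import Summits.QuantumFields.BalabanUV.Beta.WardLocusRecursive

/-!
# `BalabanUV.Beta.GAN24.CubicBackgroundGaugeLetter` — binder row G-an2-4 ∕ (CONV-C), W-slot (α-0), ROW (C) AT LEVELS `j ≥ 1`, letter L1 of the (γ) hand's memo
# `HOME/b2b-balaban-gan24-formalise-leaf-06/g51/C-LEVELS-GE1.md` §10: **THE PER-SITE BACKGROUND GAUGE LETTER OF THE W-LITERAL's CUBIC SECTOR AT EVERY LEVEL —
# `divV (e3OfK Lc G_j (SrecAt … j)) u = ½ • conjV (E2 d Lc (j+1)) (diagK (legInd ρ′ u))`**, `G_j = coDressKBmAt ρ Lc (KInvStep Lc j)`, at the Ward pin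
# `(cE, cVH) = (Lc^{d+1}, −Lc^{d+1}·½·Lc^{d+1})`, every `cΛ`, every in-block root `ρ = toSite r`, every generator root `ρ′`, every `d`, `Lc ≥ 1`
# (G-an2-4 CRUX TEAM (2), seat `b2b-balaban-gan24-formalise-leaf-06` = the (γ) hand, gen 51; journal INTENT I-leaf06-g51-1 ∕ RESULT R-leaf06-g51-2)

NOT IN PRINT; OUR BOOKKEEPING ([folklore] ONE instantiation BY NAME of leaf-10's repair-agnostic cubic Ward socket `WardLocusCubic.divV_e3K_eq_conjV` at the W-literal's
sockets, every one a LANDED theorem — exactly as an2 g39's `CombFormSlotGaugeLetter.divV_e3OfK_SrecOf_GcombSh` does it for the comb chart `GcombSh`: decay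
`AxialDressingRooted.decays_coDressKBmAt_KInvStep`, spread `BorderedHessian.spr_bhKStepAt` ∕ `AxialDressingRooted.spr_axEc`, relative inverse
`BorderedHessian.relInv_coDressKBmAt_KInvStep_bhKStepAt`, ℋ-column Ward `KernelWardHColumnWall.colH_ward_KInvStep_all` (constant `(stepScale_j·Lc^{d+1})⁻¹`), generator
localisation `KernelWardLevels.loc_diagK_smul_sum_legInd`, diagonal commutation `BorderedHessian.comp_axEc_diagK_comm`, the BLOCK law of the family at level `j` =
leaf-10's `WardLocusRecursive.hSd_SrecAt` (generator scale `½` at every level, NO hypothesis), locality `WardLocusRecursive.locStencil_SrecAt`, and the read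
`WardLocusInduction.mmRead_coDressKBmAt_KInvStep` (`mmRead Lc G_j = E2 d Lc (j+1)`); 0 `def`, 0 cited fact, 0 `def … : Prop`, 0 sorry).
HONEST FRAMING (cell contract, verbatim): «discharging `BetaPertH` makes Bałaban's UV stability UNCONDITIONAL — a real constructive-QFT result; it is NOT the continuum
limit and NOT the Clay problem.»  HONEST DEPENDENCY (verbatim): «continuum YM on T⁴ ⇐ BetaPertH ∧ nine spine estimates (0/9 proved); BetaPertH ⇐ (D1) ∧ (D4) ∧ CAP+tail;
G-an2-4 gates asym, D1 and NE2/3/4.»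

WHY (row (C) at levels `j ≥ 1`; the OWNER gan24-p1 g35 W-5: «YES — GO, THIS ROW, THIS HAND»).  The symmetrised ff zero mode of the dressed comb tower is conserved at
every level iff, per level, «cubic exchange + quartic contact = 0» with two gauge insertions (leaf-02 g62 `C-MECHANISM-v0.md` LAW A; this lineage's kit j192575 ∕ j192957:
the background-pair half in closed form at levels 0 and 1 with every constant a tree pin).  Its first letter is the per-site background gauge law of the cubic
sector `S^E_{j+1} = (cE·wE_{j+1}) • e3OfK Lc G_j (SrecAt j)` of `SpureRecAt (j+1)` (`SpineRecursiveW.SpureRecAt_succ`): contracted with a gauge function `λ` it gives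
`S^E_{j+1}(dλ) = ½(cE·wE_{j+1})·[E2_{j+1}, Λ]` (engine (T1): fitted constant `−½·cE·wE` on `−dλ`, residual ≤ 2e-16, levels 0 and 1, D = 2).  The block version is inside
`WardLocusInduction.hSd_step`'s proof as a `have`; this file names the per-site version at the W-literal so that the (C) files can import it.
* §1 **`divV_e3OfK_SrecAt`** — the statement in the title (per site `u`, generator root `ρ′` free); **`divV_e3OfK_SrecAt_inl_inl`** — the same read on the field–field
  block, entrywise: `(divV T u) x z (inl a) (inl b) = ½ · E2 d Lc (j+1) x z (inl a) (inl b) · ([z = u] − [x = u])` (an2 g39's `_inl_inl` shape one chart over);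
  **`sum_smul_divV_e3OfK_SrecAt_inl_inl`** — contracted with a finitely supported gauge function: `(Σ_{u∈T} λ u • divV T u) x z (inl a)(inl b) = ½·E2 (j+1) x z (inl a)(inl b)·(λ_T z − λ_T x)`.
Asserts NO value of Bałaban's tables; discharges NOTHING of (C) ∕ (C)sym ∕ (Q-L) ∕ «T2Shape» ∕ «T2Drift» ∕ (hW, hWall); NEVER «G-an2-4 closed» as (CONV-C); NOT D1, NOT
`BetaPertH`, NOT continuum, NOT Clay.  2026-08-23; no existing file touched.
-/

noncomputable section

open Finset
open scoped BigOperators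
open Literature.MathematicalPhysics.QuantumFieldTheory
open Literature.MathematicalPhysics.QuantumFieldTheory.Balaban1983to89
open Literature.MathematicalPhysics.QuantumFieldTheory.Balaban1983to89.Beta
open ExpKernelCalculus (MKer Decays comp)
open OneStepResolventKernel (Fib LocStencil)
open OneStepKernelFamily (KInvStep)
open KernelWard (divV)
open AffineAveraging (box toSite)
open BalabanStepJetsSucc (mmRead E2)
open Summit.QuantumFields.BalabanUV.Beta.TameKernelCalculus
open Summit.QuantumFields.BalabanUV.Beta.ChartConjugation (conjV)
open Summit.QuantumFields.BalabanUV.Beta.AxialDressingRooted (axEc coDressKBmAt spr_axEc decays_coDressKBmAt_KInvStep one_le_of_neZero)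
open Summit.QuantumFields.BalabanUV.Beta.BorderedHessian (bhKStepAt stepScale diagK comp_axEc_diagK_comm spr_bhKStepAt relInv_coDressKBmAt_KInvStep_bhKStepAt
  conjV_diagK_apply)
open Summit.QuantumFields.BalabanUV.Beta.AveragingWardRootedStencils (legInd legInd_inl)
open Summit.QuantumFields.BalabanUV.Beta.SpineRooted (e3OfK)
open Summit.QuantumFields.BalabanUV.Beta.KernelWardHColumnWall (colH_ward_KInvStep_all)
open Summit.QuantumFields.BalabanUV.Beta.KernelWardLevels (loc_diagK_smul_sum_legInd)
open Summit.QuantumFields.BalabanUV.Beta.WardLocusCubic (e3K divV_e3K_eq_conjV)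
open Summit.QuantumFields.BalabanUV.Beta.WardLocusInduction (mmRead_coDressKBmAt_KInvStep)
open Summit.QuantumFields.BalabanUV.Beta.WardLocusRecursive (SrecAt e3OfK_eq_e3K locStencil_SrecAt hSd_SrecAt)

namespace Summit.QuantumFields.BalabanUV.Beta.GAN24.CubicBackgroundGaugeLetter

variable {d : ℕ} {Lc : ℕ} [NeZero Lc]

/-! ## §1 The per-site background gauge letter of the W-literal's cubic sector, every level -/

/-- [folklore] **THE PER-SITE BACKGROUND GAUGE LETTER OF THE W-LITERAL's CUBIC SECTOR AT EVERY LEVEL.**  For `Lc ≥ 1`, an in-block root `ρ = toSite r`, any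
`cΛ`, at the Ward pin `(cE, cVH) = (Lc^{d+1}, −Lc^{d+1}·½·Lc^{d+1})`: for every level `j`, every generator root `ρ′` and every site `u` of the step-`(j+1)` lattice,
`divV (e3OfK Lc G_j (SrecAt … j)) u = ½ • conjV (E2 d Lc (j+1)) (diagK (legInd ρ′ u))`, `G_j = coDressKBmAt ρ Lc (KInvStep Lc j)` — leaf-10's
`WardLocusCubic.divV_e3K_eq_conjV` at the W-literal's landed sockets (the module docstring lists them), the level-`j` block law being `hSd_SrecAt`. -/
theorem divV_e3OfK_SrecAt {r : Fin (d + 1) → ℕ} (hr : r ∈ box (d + 1) Lc) (cΛ : ℝ) (j : ℕ) (ρ' u : Fin (d + 1) → ℤ) :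
    divV (e3OfK Lc (coDressKBmAt (toSite r) Lc (KInvStep (d := d) Lc j))
        (SrecAt d Lc (toSite r) ((Lc : ℝ) ^ (d + 1)) (-((Lc : ℝ) ^ (d + 1) * (1 / 2) * (Lc : ℝ) ^ (d + 1))) cΛ j)) u =
      (1 / 2 : ℝ) • conjV (E2 d Lc (j + 1)) (diagK (legInd ρ' u)) := by
  have hLc : 1 ≤ Lc := one_le_of_neZero Lc
  obtain ⟨Cs, δs, hδs, hS⟩ := locStencil_SrecAt (d := d) hLc hr ((Lc : ℝ) ^ (d + 1))
    (-((Lc : ℝ) ^ (d + 1) * (1 / 2) * (Lc : ℝ) ^ (d + 1))) cΛ j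
  rw [e3OfK_eq_e3K, ← mmRead_coDressKBmAt_KInvStep (d := d) (Lc := Lc) (toSite r) j]
  exact divV_e3K_eq_conjV (decays_coDressKBmAt_KInvStep (d := d) hr j) (spr_bhKStepAt (d := d) hr j) (spr_axEc _ _)
    (relInv_coDressKBmAt_KInvStep_bhKStepAt (d := d) hr j) hLc hS hδs hr
    ((stepScale d Lc j * (Lc : ℝ) ^ (d + 1))⁻¹) (1 / 2 : ℝ)
    (fun y κ' u' => colH_ward_KInvStep_all (d := d) hr j y κ' u') (fun y => loc_diagK_smul_sum_legInd Lc _ (1 / 2 : ℝ) y)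
    (fun y => comp_axEc_diagK_comm _ _ _) (fun y => hSd_SrecAt hLc hr cΛ j y) ρ' u

/-- [folklore] **THE SAME LAW READ ON THE FIELD–FIELD BLOCK, ENTRYWISE** (an2 g39's `divV_e3OfK_SrecOf_GcombSh_inl_inl` one chart over; the shape the zero-mode ∕
periodisation bookkeeping of row (C) consumes): `(divV T_{j+1} u) x z (inl a) (inl b) = ½ · E2 d Lc (j+1) x z (inl a) (inl b) · ([z = u] − [x = u])`. -/
theorem divV_e3OfK_SrecAt_inl_inl {r : Fin (d + 1) → ℕ} (hr : r ∈ box (d + 1) Lc) (cΛ : ℝ) (j : ℕ) (u x z : Fin (d + 1) → ℤ) (a b : Fin (d + 1)) :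
    divV (e3OfK Lc (coDressKBmAt (toSite r) Lc (KInvStep (d := d) Lc j))
        (SrecAt d Lc (toSite r) ((Lc : ℝ) ^ (d + 1)) (-((Lc : ℝ) ^ (d + 1) * (1 / 2) * (Lc : ℝ) ^ (d + 1))) cΛ j)) u x z (Sum.inl a) (Sum.inl b) =
      (1 / 2 : ℝ) * (E2 d Lc (j + 1) x z (Sum.inl a) (Sum.inl b) * ((if z = u then 1 else 0) - (if x = u then 1 else 0))) := by
  have h := congrFun (congrFun (congrFun (congrFun (divV_e3OfK_SrecAt (d := d) hr cΛ j u u) x) z) (Sum.inl a)) (Sum.inl b)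
  rw [h, Pi.smul_apply, Pi.smul_apply, Pi.smul_apply, Pi.smul_apply, smul_eq_mul, conjV_diagK_apply, legInd_inl, legInd_inl]

/-- [folklore] **CONTRACTED WITH A FINITELY SUPPORTED GAUGE FUNCTION** — the finite-support form of «`S^E_{j+1}(dλ) = ½[E2_{j+1}, Λ]`» (engine (T1)): for `lam` and a finite
set `T` of sites, the field–field entries of `Σ_{u ∈ T} lam u • divV T_{j+1} u` are `½ · E2 d Lc (j+1) x z (inl a) (inl b) · (λ_T z − λ_T x)`, `λ_T := lam` on `T`, `0` off `T`
(the commutator of the value Hessian with the multiplication by `λ_T`; the periodic ∕ cell-sum form is the consumer's bookkeeping). -/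
theorem sum_smul_divV_e3OfK_SrecAt_inl_inl {r : Fin (d + 1) → ℕ} (hr : r ∈ box (d + 1) Lc) (cΛ : ℝ) (j : ℕ) (T : Finset (Fin (d + 1) → ℤ))
    (lam : (Fin (d + 1) → ℤ) → ℝ) (x z : Fin (d + 1) → ℤ) (a b : Fin (d + 1)) :
    (∑ u ∈ T, lam u • divV (e3OfK Lc (coDressKBmAt (toSite r) Lc (KInvStep (d := d) Lc j))
        (SrecAt d Lc (toSite r) ((Lc : ℝ) ^ (d + 1)) (-((Lc : ℝ) ^ (d + 1) * (1 / 2) * (Lc : ℝ) ^ (d + 1))) cΛ j)) u) x z (Sum.inl a) (Sum.inl b) =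
      (1 / 2 : ℝ) * E2 d Lc (j + 1) x z (Sum.inl a) (Sum.inl b) *
        ((if z ∈ T then lam z else 0) - (if x ∈ T then lam x else 0)) := by
  rw [Finset.sum_apply, Finset.sum_apply, Finset.sum_apply, Finset.sum_apply]
  have hterm : ∀ u ∈ T, (lam u • divV (e3OfK Lc (coDressKBmAt (toSite r) Lc (KInvStep (d := d) Lc j))
      (SrecAt d Lc (toSite r) ((Lc : ℝ) ^ (d + 1)) (-((Lc : ℝ) ^ (d + 1) * (1 / 2) * (Lc : ℝ) ^ (d + 1))) cΛ j)) u) x z (Sum.inl a) (Sum.inl b) =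
      (1 / 2 : ℝ) * E2 d Lc (j + 1) x z (Sum.inl a) (Sum.inl b) * ((if z = u then lam u else 0) - (if x = u then lam u else 0)) := by
    intro u _
    rw [Pi.smul_apply, Pi.smul_apply, Pi.smul_apply, Pi.smul_apply, smul_eq_mul, divV_e3OfK_SrecAt_inl_inl hr cΛ j u x z a b]
    split_ifs <;> ring
  rw [Finset.sum_congr rfl hterm, ← Finset.mul_sum, Finset.sum_sub_distrib, Finset.sum_ite_eq, Finset.sum_ite_eq]

end Summit.QuantumFields.BalabanUV.Beta.GAN24.CubicBackgroundGaugeLetter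

end
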